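import Literature.AlgebraicGeometry.Resolution.HasseSchmidtLocalCriterion
import Literature.RingTheory.MvPowerSeries.FrobeniusPowerBasis
import Mathlib.Algebra.CharP.Lemmas
import HarnessLib

/-!
# Hasse–Schmidt homomorphisms in characteristic `p`: the Frobenius rule `D^{[p^N γ]}(a^{p^N}) = (D^{[γ]} a)^{p^N}`
# and the congruence `D^{[p^N γ]}(g^{p^N} F) ≡ (D^{[γ]} g)^{p^N} · F (mod I^{p^N})` for `g ∈ I^{|γ|}`

Topic: `Literature/AlgebraicGeometry/Resolution`. Companion of `TaylorOrderBound.lean` (the components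
`D^{[β]} = hsComponent T β` of a ring homomorphism `T : O → O⟦t_σ⟧`, their Leibniz rule `hsComponent_mul` and
`hsComponent_mem_pow` : `D^{[β]}(I^e) ⊆ I^{e−|β|}`), `TaylorUnitOrderCriterion.lean` (`hsComponentₗ`,
`isDiffOpLE_hsComponentₗ` : `D^{[β]}` is a differential operator of order `≤ |β|`) and
`HasseSchmidtLocalCriterion.lean` (the ORDER CRITERION: in a local ring with a Hasse–Schmidt homomorphism and
first-order-adapted generators of `𝔪`, an element of `𝔪^q ∖ 𝔪^{q+1}` is taken to a UNIT by some `D^{[γ]}`, `|γ| = q`).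
Here the ring has (exponential) characteristic `p` and we add the interaction with the FROBENIUS:

* `hsComponent_pow_expChar_pow_eq_zero_of_not_dvd` — `D^{[β]}(a^{p^N}) = 0` whenever some coordinate of `β` is not a
  multiple of `p^N`;
* `hsComponent_smul_pow_expChar_pow` — **`D^{[p^N • γ]}(a^{p^N}) = (D^{[γ]} a)^{p^N}`** for every `γ`.
  Both are the coefficientwise content of `T(a^{p^N}) = T(a)^{p^N}` in `O⟦t⟧`, where a `p^N`-th power is
  `Σ_m c_m^{p^N} t^{p^N m}` (Mathlib `MvPowerSeries.map_iterateFrobenius_expand`, packaged in the tree as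
  `Literature.RingTheory.MvPowerSeries.coeff_smul_pow_pow` / `isSupportedOnMultiples_pow`). For ONE power series ring
  and its partial Hasse derivatives this is `Literature.RingTheory.MvPowerSeries.hasseDeriv_smul_pow_char_pow`
  (`HasseDerivFrobeniusPow.lean`); the point of the present file is that it holds for EVERY Hasse–Schmidt homomorphism of
  EVERY ring of characteristic `p` (Matsumura §27: higher derivations are ring homomorphisms `E_t`, so
  `E_t(a^p) = E_t(a)^p`).
* `hsComponent_smul_apply_pow_mul_eq_sum` — the Leibniz–Frobenius expansion
  `D^{[p^N γ]}(a^{p^N} F) = Σ_{δ+δ'=γ} (D^{[δ]} a)^{p^N} · D^{[p^N δ']} F`.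
* `hsComponent_smul_apply_pow_mul_sub_mem_pow` — **the congruence**: for ANY ideal `I` and `g ∈ I^{|γ|}`,
  `D^{[p^N γ]}(g^{p^N} F) − (D^{[γ]} g)^{p^N} F ∈ I^{p^N}` for every `N` and every `F` (the terms `δ ≠ γ` of the
  expansion carry the factor `(D^{[δ]} g)^{p^N}` with `D^{[δ]} g ∈ I^{|γ|−|δ|} ⊆ I`).
* `exists_isUnit_hsComponent_and_sub_mem_pow` — in a LOCAL ring with first-order-adapted generators of `𝔪`
  (setting of `HasseSchmidtLocalCriterion.lean`): for `g ∈ 𝔪^q ∖ 𝔪^{q+1}` there is `γ`, `|γ| = q`, with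
  `u := D^{[γ]} g` a unit and `D^{[p^N γ]}(g^{p^N} F) − u^{p^N} F ∈ 𝔪^{p^N}` for all `N`, `F`;
  `exists_isDiffOpLE_pow_mul_sub_mem_pow` — the same with `D^{[p^N γ]}` packaged as a `K`-linear differential
  operator of order `≤ p^N q` (Grothendieck's sense, the tree's `IsDiffOpLE`).

Motivation (nothing of it is asserted here): this is the operator identity displayed in H. Hironaka's 2017 manuscript
at p.31 l.9–19 (Eq. (47): «∂^{(p^ℓα)}(g^{p^ℓ} fh) ≡ u^{p^ℓ} fh mod max(O_ξ)^{p^ℓ}», with the expansion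
«∂^{(p^ℓα)}(g^{p^ℓ} fh) = Σ_β (∂^{(β)} g)^{p^ℓ} ∂^{(p^ℓ(α−β))}(fh)»), used again at p.38 (Lem. 7.10 / Th. 7.11); the
campaign `res-hironaka` (lane HIRONAKA-L) proved it on the completion `K⟦x⟧`
(`Hironaka2017/Proofs/S06BaseHike/U31L8.lean`) and asked for the local-ring form (CELL/STATUS LIB-WANTED
2026-08-27T00:26:14Z). The closed-point / étale-coordinates packaging is `SmoothPointFrobeniusCongruence.lean`.

## Sources
* [Matsumura1987] H. Matsumura, *Commutative Ring Theory* (1986), §27 (higher derivations = ring homomorphisms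
  `E_t : A → A⟦t⟧`; hence `E_t(a^p) = E_t(a)^p`), §30 proof of Thm. 30.9 (coefficients of `p`-th powers).
* [EGAIV4] A. Grothendieck, J. Dieudonné, ÉGA IV₄ (1967), §16.8, Thm. 16.11.2 (the `D_q` are differential operators
  of order `≤ |q|`).
* [Abad2019pBases] C. Abad, J. Algebra 523 (2019), Lemma 6.2 (behaviour of Hasse–Schmidt derivatives on `p^e`-th powers).
-/

noncomputable section

namespace Literature.AlgebraicGeometry.Resolution

open Finsupp IsLocalRing
open Literature.RingTheory.MvPowerSeries (coeff_smul_pow_pow isSupportedOnMultiples_pow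
  eq_smul_mapRange_div_of_forall_dvd)

universe u v

section Frobenius

variable {O : Type v} [CommRing O] {σ : Type*} (T : O →+* MvPowerSeries σ O) (p : ℕ) [ExpChar O p]

/-- **`D^{[β]}(a^{p^N}) = 0` off the lattice `p^N ℕ^σ`**: if some coordinate `β_s` is not a multiple of `p^N`, the
`β`-component of any Hasse–Schmidt homomorphism kills `p^N`-th powers (`T(a^{p^N}) = T(a)^{p^N}` is supported on
`p^N ℕ^σ`). [cite: Matsumura1987, §27 (E_t is a ring homomorphism) and §30 proof of Thm. 30.9 (p-th powers of series)] -/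
theorem hsComponent_pow_expChar_pow_eq_zero_of_not_dvd {N : ℕ} {β : σ →₀ ℕ} (hβ : ∃ s, ¬ p ^ N ∣ β s) (a : O) :
    hsComponent T β (a ^ p ^ N) = 0 := by
  rw [hsComponent, map_pow]
  exact isSupportedOnMultiples_pow p (T a) N β hβ

/-- **Frobenius rule for Hasse–Schmidt homomorphisms**: `D^{[p^N • γ]}(a^{p^N}) = (D^{[γ]} a)^{p^N}` in exponential
characteristic `p`, for every ring homomorphism `T : O → O⟦t_σ⟧` and its components `D^{[β]} = coeff_β ∘ T`
(`(Σ_m c_m t^m)^{p^N} = Σ_m c_m^{p^N} t^{p^N m}`). [cite: Matsumura1987, §27 (E_t(a^p) = E_t(a)^p) and §30 proof of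
Thm. 30.9] [cite: Abad2019pBases, Lemma 6.2] -/
theorem hsComponent_smul_pow_expChar_pow (N : ℕ) (γ : σ →₀ ℕ) (a : O) :
    hsComponent T (p ^ N • γ) (a ^ p ^ N) = (hsComponent T γ a) ^ p ^ N := by
  rw [hsComponent, hsComponent, map_pow]
  exact coeff_smul_pow_pow p (T a) N γ

omit [ExpChar O p] in
/-- Bookkeeping on the antidiagonal of `p^N • γ`: a pair `(β₁, β₂)` with `β₁ + β₂ = p^N • γ` and `β₁` on the lattice
`p^N ℕ^σ` is `(p^N • δ₁, p^N • δ₂)` for a (unique) pair `δ₁ + δ₂ = γ`. [folklore] -/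
private theorem mem_image_smul_of_forall_dvd [DecidableEq σ] {N : ℕ} (hq : 0 < p ^ N) {γ : σ →₀ ℕ}
    {x : (σ →₀ ℕ) × (σ →₀ ℕ)} (hx : x ∈ Finset.antidiagonal (p ^ N • γ)) (hdvd : ∀ s, p ^ N ∣ x.1 s) :
    x ∈ (Finset.antidiagonal γ).image (fun δ : (σ →₀ ℕ) × (σ →₀ ℕ) => (p ^ N • δ.1, p ^ N • δ.2)) := by
  rw [Finset.mem_antidiagonal] at hx
  set δ₁ : σ →₀ ℕ := Finsupp.mapRange (fun x => x / p ^ N) (Nat.zero_div _) x.1 with hδ₁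
  have hx1 : x.1 = p ^ N • δ₁ := eq_smul_mapRange_div_of_forall_dvd hdvd
  -- coordinatewise: `p^N δ₁ s + x.2 s = p^N γ s`
  have hcoord : ∀ s, p ^ N * δ₁ s + x.2 s = p ^ N * γ s := by
    intro s
    have := DFunLike.congr_fun hx s
    rw [Finsupp.add_apply, hx1, Finsupp.smul_apply, Finsupp.smul_apply, smul_eq_mul, smul_eq_mul] at this
    exact this
  have hle : δ₁ ≤ γ := by
    intro s
    have := hcoord s
    nlinarith [Nat.zero_le (x.2 s)]
  refine Finset.mem_image.mpr ⟨(δ₁, γ - δ₁), ?_, ?_⟩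
  · rw [Finset.mem_antidiagonal]
    exact add_tsub_cancel_of_le hle
  · refine Prod.ext hx1.symm ?_
    ext s
    simp only [Finsupp.smul_apply, smul_eq_mul, Finsupp.tsub_apply]
    have := hcoord s
    have h2 : x.2 s = p ^ N * γ s - p ^ N * δ₁ s := by omega
    rw [h2, Nat.mul_sub]

/-- **Leibniz–Frobenius expansion**: `D^{[p^N γ]}(a^{p^N} · F) = Σ_{δ + δ' = γ} (D^{[δ]} a)^{p^N} · D^{[p^N δ']} F`
(Leibniz over the antidiagonal of `p^N γ`; the components of `a^{p^N}` vanish off `p^N ℕ^σ` and are `p^N`-th powers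
on it). [cite: Matsumura1987, §27 (higher derivations: Leibniz rule, E_t multiplicative)] -/
theorem hsComponent_smul_apply_pow_mul_eq_sum [DecidableEq σ] (N : ℕ) (γ : σ →₀ ℕ) (a F : O) :
    hsComponent T (p ^ N • γ) (a ^ p ^ N * F) =
      ∑ δ ∈ Finset.antidiagonal γ, (hsComponent T δ.1 a) ^ p ^ N * hsComponent T (p ^ N • δ.2) F := by
  have hq : 0 < p ^ N := pow_pos (expChar_pos O p) N
  rw [hsComponent_mul]
  -- the image of `antidiagonal γ` under `δ ↦ p^N • δ` inside `antidiagonal (p^N • γ)`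
  set e : (σ →₀ ℕ) × (σ →₀ ℕ) → (σ →₀ ℕ) × (σ →₀ ℕ) := fun δ => (p ^ N • δ.1, p ^ N • δ.2) with he
  have hinj : Set.InjOn e ↑(Finset.antidiagonal γ) := by
    intro δ _ δ' _ h
    simp only [he, Prod.mk.injEq] at h
    refine Prod.ext ?_ ?_
    · ext s
      have := DFunLike.congr_fun h.1 s
      simp only [Finsupp.smul_apply, smul_eq_mul] at this
      exact Nat.eq_of_mul_eq_mul_left hq this
    · ext s
      have := DFunLike.congr_fun h.2 s
      simp only [Finsupp.smul_apply, smul_eq_mul] at this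
      exact Nat.eq_of_mul_eq_mul_left hq this
  have hsub : (Finset.antidiagonal γ).image e ⊆ Finset.antidiagonal (p ^ N • γ) := by
    intro x hx
    obtain ⟨δ, hδ, rfl⟩ := Finset.mem_image.mp hx
    rw [Finset.mem_antidiagonal] at hδ ⊢
    simp only [he, ← smul_add, hδ]
  rw [← Finset.sum_subset hsub, Finset.sum_image hinj]
  · refine Finset.sum_congr rfl fun δ _ => ?_
    simp only [he, hsComponent_smul_pow_expChar_pow T p N]
  · -- terms off the lattice vanish
    intro x hx hnot
    have hndvd : ∃ s, ¬ p ^ N ∣ x.1 s := by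
      by_contra hall
      push Not at hall
      exact hnot (mem_image_smul_of_forall_dvd p hq hx hall)
    rw [hsComponent_pow_expChar_pow_eq_zero_of_not_dvd T p hndvd, zero_mul]

/-- If `δ + δ' = γ` and `(δ, δ') ≠ (γ, 0)` then `|δ| < |γ|`. [folklore] -/
private theorem degree_fst_lt_of_mem_antidiagonal_of_ne [DecidableEq σ] {γ : σ →₀ ℕ} {δ : (σ →₀ ℕ) × (σ →₀ ℕ)}
    (hδ : δ ∈ Finset.antidiagonal γ) (hne : δ ≠ (γ, 0)) : degree δ.1 < degree γ := by
  rw [Finset.mem_antidiagonal] at hδ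
  have hdeg : degree δ.1 + degree δ.2 = degree γ := by rw [← map_add, hδ]
  have h2 : δ.2 ≠ 0 := by
    intro h2
    apply hne
    rw [h2, add_zero] at hδ
    exact Prod.ext hδ h2
  have h2' : 1 ≤ degree δ.2 := by
    rw [Nat.one_le_iff_ne_zero, Ne, degree_eq_zero_iff]; exact h2
  omega

/-- **The Frobenius congruence** (every Hasse–Schmidt homomorphism with `constantCoeff ∘ T = id`, every ideal `I`):
if `g ∈ I^{|γ|}` then for every `N` and every `F`,
`D^{[p^N γ]}(g^{p^N} · F) − (D^{[γ]} g)^{p^N} · F ∈ I^{p^N}`. In the expansion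
`hsComponent_smul_apply_pow_mul_eq_sum` the term `δ = γ` is `(D^{[γ]} g)^{p^N} F` (`D^{[0]} = id`) and every other
term carries `(D^{[δ]} g)^{p^N}` with `|δ| < |γ|`, `D^{[δ]} g ∈ I^{|γ|−|δ|} ⊆ I` (`hsComponent_mem_pow`).
[cite: Matsumura1987, §27 (higher derivations)] [cite: Abad2019pBases, Lemma 6.2] -/
theorem hsComponent_smul_apply_pow_mul_sub_mem_pow [DecidableEq σ]
    (hT0 : ∀ b, MvPowerSeries.constantCoeff (T b) = b) {I : Ideal O} {γ : σ →₀ ℕ} {g : O}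
    (hg : g ∈ I ^ degree γ) (N : ℕ) (F : O) :
    hsComponent T (p ^ N • γ) (g ^ p ^ N * F) - (hsComponent T γ g) ^ p ^ N * F ∈ I ^ p ^ N := by
  rw [hsComponent_smul_apply_pow_mul_eq_sum T p N γ g F]
  have hmem : ((γ, 0) : (σ →₀ ℕ) × (σ →₀ ℕ)) ∈ Finset.antidiagonal γ := by simp
  rw [← Finset.add_sum_erase _ _ hmem]
  simp only [smul_zero, hsComponent_zero T hT0, add_sub_cancel_left]
  refine Ideal.sum_mem _ fun δ hδ => ?_
  obtain ⟨hne, hδ'⟩ := Finset.mem_erase.mp hδ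
  have hlt := degree_fst_lt_of_mem_antidiagonal_of_ne hδ' hne
  have h1 : hsComponent T δ.1 g ∈ I := by
    have := hsComponent_mem_pow T hT0 I (degree γ) δ.1 hg
    exact Ideal.pow_le_self (by omega) this
  exact Ideal.mul_mem_right _ _ (Ideal.pow_mem_pow h1 _)

/-- The congruence read with `F = 1`: `D^{[p^N γ]}(g^{p^N}) ≡ (D^{[γ]} g)^{p^N}` EXACTLY (no error term) — recorded as
the special case `hsComponent_smul_pow_expChar_pow`; and read modulo `I^{p^N}` with the roles made explicit:
`∃ B ∈ I^{p^N}, D^{[p^N γ]}(g^{p^N} F) = (D^{[γ]} g)^{p^N} F + B`. [cite: Matsumura1987, §27] -/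
theorem exists_hsComponent_smul_apply_pow_mul_eq_add [DecidableEq σ]
    (hT0 : ∀ b, MvPowerSeries.constantCoeff (T b) = b) {I : Ideal O} {γ : σ →₀ ℕ} {g : O}
    (hg : g ∈ I ^ degree γ) (N : ℕ) (F : O) :
    ∃ B ∈ I ^ p ^ N, hsComponent T (p ^ N • γ) (g ^ p ^ N * F) = (hsComponent T γ g) ^ p ^ N * F + B :=
  ⟨_, hsComponent_smul_apply_pow_mul_sub_mem_pow T p hT0 hg N F, by ring⟩

end Frobenius

/-! ## Local rings: the unit form -/

section Local

variable {K : Type u} [CommRing K] {O : Type v} [CommRing O] [IsLocalRing O] [Algebra K O]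
  {σ : Type*} [Fintype σ] [DecidableEq σ] (T : O →+* MvPowerSeries σ O) (p : ℕ) [ExpChar O p]

/-- **Unit form of the Frobenius congruence in a local ring.** Let `O` be local with a Hasse–Schmidt homomorphism
`T` (`constantCoeff ∘ T = id`) and generators `u_i` of `𝔪` adapted to `T` to first order (`D^{[e_j]} u_i ≡ δ_ij`).
If `g ∈ 𝔪^q ∖ 𝔪^{q+1}` then there is `γ` with `|γ| = q` such that `u := D^{[γ]} g` is a UNIT and
`D^{[p^N γ]}(g^{p^N} F) − u^{p^N} F ∈ 𝔪^{p^N}` for every `N` and every `F` (order criterion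
`exists_hsComponent_isUnit_of_mem_of_not_mem` + `hsComponent_smul_apply_pow_mul_sub_mem_pow`).
[cite: VillamayorU2008ReesDiff, §4.1 and Remark 4.3] [cite: Matsumura1987, §27] -/
theorem exists_isUnit_hsComponent_and_sub_mem_pow (hT0 : ∀ b, MvPowerSeries.constantCoeff (T b) = b)
    {u : σ → O} (hu : Ideal.span (Set.range u) = maximalIdeal O)
    (hlin : ∀ i j, hsComponent T (single j 1) (u i) - (if i = j then 1 else 0) ∈ maximalIdeal O)
    {q : ℕ} {g : O} (h1 : g ∈ maximalIdeal O ^ q) (h2 : g ∉ maximalIdeal O ^ (q + 1)) :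
    ∃ γ : σ →₀ ℕ, degree γ = q ∧ IsUnit (hsComponent T γ g) ∧
      ∀ (N : ℕ) (F : O),
        hsComponent T (p ^ N • γ) (g ^ p ^ N * F) - (hsComponent T γ g) ^ p ^ N * F ∈ maximalIdeal O ^ p ^ N := by
  obtain ⟨γ, hγ, hunit⟩ := exists_hsComponent_isUnit_of_mem_of_not_mem T hT0 hu hlin h1 h2
  exact ⟨γ, hγ, hunit, fun N F => hsComponent_smul_apply_pow_mul_sub_mem_pow T p hT0 (hγ.symm ▸ h1) N F⟩

/-- **Differential-operator form.** In the setting of `exists_isUnit_hsComponent_and_sub_mem_pow`, with `T` sending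
`K` to constants: for `g ∈ 𝔪^q ∖ 𝔪^{q+1}` there is a unit `u` such that for every `N` some `K`-linear differential
operator `D` of `O` of order `≤ p^N q` (Grothendieck's sense, `IsDiffOpLE`) satisfies
`D (g^{p^N} F) − u^{p^N} F ∈ 𝔪^{p^N}` for all `F` — namely `D = D^{[p^N γ]}`, `u = D^{[γ]} g`.
[cite: EGAIV4, §16.8 and Thm. 16.11.2] [cite: VillamayorU2008ReesDiff, §4.1 and Remark 4.3] -/
theorem exists_isDiffOpLE_pow_mul_sub_mem_pow (hT0 : ∀ b, MvPowerSeries.constantCoeff (T b) = b)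
    (hTK : ∀ c : K, T (algebraMap K O c) = MvPowerSeries.C (algebraMap K O c)) {u : σ → O}
    (hu : Ideal.span (Set.range u) = maximalIdeal O)
    (hlin : ∀ i j, hsComponent T (single j 1) (u i) - (if i = j then 1 else 0) ∈ maximalIdeal O)
    {q : ℕ} {g : O} (h1 : g ∈ maximalIdeal O ^ q) (h2 : g ∉ maximalIdeal O ^ (q + 1)) :
    ∃ v : O, IsUnit v ∧ ∀ N : ℕ, ∃ D : O →ₗ[K] O, IsDiffOpLE K (p ^ N * q) D ∧
      ∀ F : O, D (g ^ p ^ N * F) - v ^ p ^ N * F ∈ maximalIdeal O ^ p ^ N := by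
  obtain ⟨γ, hγ, hunit, hcong⟩ := exists_isUnit_hsComponent_and_sub_mem_pow T p hT0 hu hlin h1 h2
  refine ⟨hsComponent T γ g, hunit, fun N => ⟨hsComponentₗ T hTK (p ^ N • γ), ?_, fun F => hcong N F⟩⟩
  refine isDiffOpLE_hsComponentₗ T hTK hT0 (p ^ N * q) (p ^ N • γ) (le_of_eq ?_)
  rw [map_nsmul, smul_eq_mul, hγ]

end Local

end Literature.AlgebraicGeometry.Resolution
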